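import Literature.Analysis.FunctionSpaces.TorusCalculusProofs
import Summits.AtomisticToContinuum.HydrodynamicLimit.Theorems.CollisionIsometryCLTMacroClosureDefs

/-!
# Stub `stub_balance_B2` of the line `IdeatorTwoGen1Sketch` (crux `MacroClosure`, stmt-14870):
# the free-transport derivative of the tested kinetic observable

Conjunct (B2) of `BalanceIdentity`: for smooth test fields `ψ : T³ → ℝ³`, `χ : T³ → ℝ` and an
`(N+1)`-particle configuration `z`, the tested observable
`O(z) = ⟨emp z, ψ(x)·v + χ(x)|v|²/2⟩ = (N+1)⁻¹ Σᵢ (ψ(xᵢ)·vᵢ + χ(xᵢ)|vᵢ|²/2)` satisfies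
`d/dr|_{r=0} O(freeFlight r z) = ⟨emp z, Σⱼₖ ∂ⱼψₖ vⱼvₖ + Σⱼ ∂ⱼχ vⱼ|v|²/2⟩`.

Proof: free flight moves particle `i` to `xᵢ + proj (r • vᵢ)` with unchanged velocity
(`freeFlight_apply`, `Torus.geometry_translate`); the empirical integral is a finite average
(`integral_empiricalMeasure`); each particle term is differentiated with the torus chain rule along a
line (`Torus.hasDerivAt_comp_add_proj_smul`, `Torus.fderiv_apply_eq_sum_partialDeriv`:
`d/dr f(x + proj (r • v)) = Σⱼ vⱼ ∂ⱼf(x)` at `r = 0`), and the finite sums are rearranged.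
-/

noncomputable section

open MeasureTheory Filter Set Topology InformationTheory
open scoped ENNReal ContDiff

namespace Summit.AtomisticToContinuum.HydrodynamicLimit.Theorems.MacroClosureLine

open Literature.MathematicalPhysics.KineticTheory Literature.Analysis.FluidPDE
open Literature.Analysis.FunctionSpaces

namespace Barycentric

/-- Chain rule along a uniform motion on `T³` at time `0`: for smooth `f : T³ → ℝ`,
`d/dr|_{r=0} f (x + proj (r • v)) = Σⱼ vⱼ ∂ⱼf(x)`. -/
theorem hasDerivAt_comp_freeLine_zero {f : T3 → ℝ} (hf : Torus.IsSmooth f) (x : T3) (v : V3) :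
    HasDerivAt (fun r : ℝ => f (x + Torus.proj (r • v)))
      (∑ j, v j * Torus.partialDeriv j f x) 0 := by
  have h1 : Torus.IsContDiff 1 f := hf.isContDiff (by simp)
  have h := Torus.hasDerivAt_comp_add_proj_smul h1 x v 0
  rw [zero_smul, Torus.proj_zero, add_zero, Torus.lineDeriv_eq_fderiv_apply h1,
    Torus.fderiv_apply_eq_sum_partialDeriv h1] at h
  simpa only [smul_eq_mul] using h

/-- One particle: the derivative at `r = 0` of `Σⱼ ψⱼ(x + proj (r • v)) vⱼ + χ(x + proj (r • v)) |v|²/2`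
is `Σⱼₖ ∂ⱼψₖ(x) vⱼvₖ + Σⱼ ∂ⱼχ(x) vⱼ|v|²/2`. -/
theorem hasDerivAt_particle_observable {ψ : T3 → V3} {χ : T3 → ℝ} (hψ : Torus.IsSmooth ψ)
    (hχ : Torus.IsSmooth χ) (x : T3) (v : V3) :
    HasDerivAt (fun r : ℝ => (∑ j, ψ (x + Torus.proj (r • v)) j * v j) +
        χ (x + Torus.proj (r • v)) * (‖v‖ ^ 2 / 2))
      ((∑ j, ∑ k, Torus.partialDeriv j (fun x => ψ x k) x * (v j * v k)) +
        ∑ j, Torus.partialDeriv j χ x * (v j * (‖v‖ ^ 2 / 2))) 0 := by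
  have hψ' : ∀ k ∈ (Finset.univ : Finset (Fin 3)),
      HasDerivAt (fun r : ℝ => ψ (x + Torus.proj (r • v)) k * v k)
        ((∑ j, v j * Torus.partialDeriv j (fun x => ψ x k) x) * v k) 0 :=
    fun k _ => (hasDerivAt_comp_freeLine_zero (hψ.apply k) x v).mul_const _
  have hχ' : HasDerivAt (fun r : ℝ => χ (x + Torus.proj (r • v)) * (‖v‖ ^ 2 / 2))
      ((∑ j, v j * Torus.partialDeriv j χ x) * (‖v‖ ^ 2 / 2)) 0 :=
    (hasDerivAt_comp_freeLine_zero hχ x v).mul_const _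
  refine ((HasDerivAt.fun_sum hψ').add hχ').congr_deriv ?_
  congr 1
  · simp only [Finset.sum_mul]
    rw [Finset.sum_comm]
    exact Finset.sum_congr rfl fun j _ => Finset.sum_congr rfl fun k _ => by ring
  · rw [Finset.sum_mul]
    exact Finset.sum_congr rfl fun j _ => by ring

/-! ## The stub -/

/-- **(B2) of `BalanceIdentity`.** The free-transport derivative of CTL's tested observable
`O(z) = ⟨emp z, ψ(x)·v + χ(x)|v|²/2⟩` at `r = 0` is the microscopic kinetic flux
`⟨emp z, Σⱼₖ ∂ⱼψₖ vⱼvₖ + Σⱼ ∂ⱼχ vⱼ|v|²/2⟩`: the empirical integrals are finite averages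
(`integral_empiricalMeasure`) of the one-particle terms `hasDerivAt_particle_observable`. -/
theorem stub_balance_B2 : ∀ (N : ℕ) (ψ : T3 → V3) (χ : T3 → ℝ), Torus.IsSmooth ψ → Torus.IsSmooth χ → ∀ z : Config (N + 1) (Fin 3) T3, HasDerivAt (fun r : ℝ => ∫ y, ((∑ j, ψ y.1 j * y.2 j) + χ y.1 * (‖y.2‖ ^ 2 / 2)) ∂(empiricalMeasure (freeFlight (Torus.geometry (Fin 3)) r z))) (∫ y, ((∑ j, ∑ k, Torus.partialDeriv j (fun x => ψ x k) y.1 * (y.2 j * y.2 k)) + ∑ j, Torus.partialDeriv j χ y.1 * (y.2 j * (‖y.2‖ ^ 2 / 2))) ∂(empiricalMeasure z)) 0 := by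
  intro N ψ χ hψ hχ z
  simp only [integral_empiricalMeasure, freeFlight_apply, Torus.geometry_translate]
  exact (HasDerivAt.fun_sum fun i _ => hasDerivAt_particle_observable hψ hχ (z i).1 (z i).2).const_mul _

end Barycentric

end Summit.AtomisticToContinuum.HydrodynamicLimit.Theorems.MacroClosureLine

end
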